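import Literature.AlgebraicGeometry.Motives.HodgeStructureLefschetzGroupDirectSumPoints
import Literature.AlgebraicGeometry.Motives.MumfordTateGroupDiagonal
import HarnessLib

/-!
# Milne 1999, Proposition 1.5 ON `K`-POINTS for FINITE FAMILIES AND POWERS of polarized `ℚ`-Hodge structures:
# `S(⊕_j H_j)(K) ⊆ ∏_j S(H_j)(K)` block-diagonally for every field `K ⊇ ℚ`, with equality iff the summands are pairwise
# `Hom`-orthogonal; `S(H^{⊕ι})(K) = Δ S(H)(K)`

[topic AlgebraicGeometry/Motives]

Layer `Literature/AlgebraicGeometry/Motives`, lane `lit-hodgefound` (Track 2 foundations library; seat `lit-hodgefound-p34`,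
generation 21, FILE 2 of the self-proposed row g21-#2). Three definitions WITH BODIES (`Polarization.lefschetzGroupBaseChangePiBlock`,
`Polarization.lefschetzGroupBaseChangePiMulEquiv`, `Polarization.lefschetzGroupBaseChangePiConstMulEquiv`) and theorems; no named
fact (net debt `0`). The `K`-POINTS companion of g21-#2 `Motives/HodgeStructureLefschetzGroupFiniteDirectSum` (which treats the
`ℚ`-points `S(H)(ℚ) = Polarization.lefschetzGroup` and the algebra `C(H)`), and the FINITE-FAMILY sequel of g18-#5
`Motives/HodgeStructureLefschetzGroupDirectSumPoints` (binary sums `H₁ ⊕ H₂`, which printed «NOT here: `s > 2` summands and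
`r > 2`»). Milne's `S(A)` is an ALGEBRAIC GROUP over the coefficient field `k` of the Weil cohomology and Proposition 1.5 is an
isomorphism of algebraic groups; read through the functor of points (Remark 1.6) it is, for the Betti theory (`k = ℚ`) and every
field `K ⊇ ℚ`, a statement about the groups `S(H)(K) = Polarization.lefschetzGroupBaseChange K Q ≤ GL(K ⊗_ℚ V)` of g18-#1
`Motives/HodgeStructureLefschetzGroupPoints` (the `γ` commuting with every `a_K`, `a ∈ E_φ = End_HS(H)`, and preserving `Q_K`).
This file proves it for a finite family `(H_j, Q_j)_{j ∈ ι}` on the tree's carrier `HodgeStructure.pi H` polarized by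
`Polarization.pi Q` (`Motives/HodgeStructureDirectSum`: `(⊕_j Q_j)((x_j), (y_j)) = Σ_j Q_j(x_j, y_j)`), with the block-diagonal
embedding `piBlockDiag K W : (Π_j GL(K ⊗ W_j)) →* GL(K ⊗ Π_j W_j)` and the diagonal `piDiagEmbedding K V ι : GL(K ⊗ V) →* GL(K ⊗ V^{⊕ι})`
of the tree's `Motives/MumfordTateGroupDiagonal` (there used for `MT(⊕_j H_j)(K)`; Moonen's Lemma 4.6 / Exercise 4.10 machinery,
Mathlib's `TensorProduct.piRight`), and the restriction-to-a-retract `restrictRetract` of `Motives/MumfordTateGroupDirectSum`.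
The torus-level twin (products of period lattices, real points) is p22's `Geometry/Kaehler/ComplexTorusLefschetzGroupFiniteProduct`
(`IsRiemannForm.lefschetzGroupPiMulEquiv`) and the `ℂ`-points twin on `H¹(A(ℂ); ℂ)` is `Milne1999/LefschetzGroupProducts` — OTHER
carriers, BY NAME, nothing imported or restated; the Mumford–Tate analogues (`mumfordTateGroupBaseChange_pi_le`,
`mumfordTateGroupBaseChange_pi_const_eq`) live in `Motives/MumfordTateGroupDiagonal`.

## The source, verbatim

J. S. Milne, *Lefschetz classes on abelian varieties*, Duke Math. J. **96** (1999) 639–675 [Milne1999LefschetzClasses]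
(held `paper:doi-10-1215-s0012-7094-99-09620-5`, author's folios; Duke page ≈ folio + 638):
* §1 p0005 L12–L16 (p. 643): "For any positive integer `r`, `V(A^r) = rV(A)`, and the diagonal action of `C(A)` on `rV(A)`
  identifies `C(A)` with `C(A^r)` (as `k`-algebras with involution). Let `A = A₁ × ⋯ × A_s`. Then
  `C(A) ⊂ C(A₁) × ⋯ × C(A_s)`, with equality holding if and only if `Hom(Aᵢ, Aⱼ) = 0` for all `i, j`, `i ≠ j`."
* §1 p0005 L21–L27 (p. 643): "Moreover, if `Dᵢ` is an ample divisor on `Aᵢ`, `i = 1, …, s`, then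
  `D = Σᵢ A₁ × ⋯ × A_{i-1} × Dᵢ × A_{i+1} × ⋯ × A_s` is an ample divisor on `A`, and the involution it defines on `C(A)` is the
  restriction of the product of the involutions on the `C(Aᵢ)` defined by the `Dᵢ`."
* §1 p0006 L16–L21 (p. 644): "**The group `S(A)`.** For an abelian variety `A` over `Ω`, we define `S(A)` to be the algebraic
  subgroup of `GL(V(A))` such that, for all commutative `k`-algebras `R`, `S(A)(R) = {γ ∈ C(A) ⊗_k R | γ†γ = 1}`. […] Clearly
  `S(A)` depends only on the isogeny class of `A` (up to a unique isomorphism)."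
* §1 p0006 L24–L29 (p. 644): "**Proposition 1.5.** Let `A₁, …, A_s` be a set of representatives for the simple isogeny factors
  of `A`, so that there exists an isogeny `A₁^{r₁} × ⋯ × A_s^{r_s} → A` for some `rᵢ > 0`. Any such isogeny induces an isomorphism
  `S(A₁) × ⋯ × S(A_s) → S(A)`, which is independent of the choice of the isogeny. Proof. This is an immediate consequence of
  Proposition 1.1."
* §1 p0006 L30–L34 (p. 644): "**Remark 1.6.** If `X ↦ H*(X)` is a Weil cohomology theory with coefficient field `k`, and `k'` is
  a field containing `k`, then `X ↦ H*(X) ⊗_k k'` is a Weil cohomology theory with coefficient field `k'`. If `C'(A)` and `S'(A)`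
  denote the objects defined relative to the second theory, then there are canonical isomorphisms `C'(A) ≅ C(A) ⊗_k k'`,
  `S'(A) ≅ S(A)_{/k'}`."
* §3 p0016 L16–L17 (p. 654): "It follows from Proposition 1.5 that `S(A) = S(A^r)`".
* B. Moonen, *An introduction to Mumford–Tate groups* (2004) [Moonen2004MT], §4 Lemma 4.6 and Exercise 4.10 (automorphisms of
  `V₁ ⊕ ⋯ ⊕ V_s` commuting with the projectors; the diagonal; the tree's `restrictRetract`, `piBlockDiag`, `piDiagEmbedding`).

## What is PROVED (finite families and powers, `K`-points for every field `K ⊇ ℚ`)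

Notation: `(in_j)_K = (LinearMap.single ℚ W j).baseChange K`, `(pr_j)_K = (LinearMap.proj j).baseChange K`,
`⊕_j γ_j = piBlockDiag K W γ`, `Δ(γ₀) = piDiagEmbedding K V ι γ₀`.
* §0 **the direct-sum form after extension of scalars**: `(⊕_j Q_j)_K(x, y) = Σ_j (Q_j)_K((pr_j)_K x, (pr_j)_K y)`
  (`Polarization.baseChange_pi_form_apply`), `= (Q_j)_K(x, y)` on `(in_j)_K x, (in_j)_K y` and `= 0` across distinct summands
  (`Polarization.baseChange_pi_form_single_baseChange_same`, `…_of_ne`).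
* §1 **`S(⊕_j H_j)(K) ⊆ ∏_j S(H_j)(K)`**: `γ ∈ S(⊕_j H_j)(K)` commutes with `(in_i φ pr_j)_K` for every morphism `φ : H_j → H_i`
  and with the idempotents `(in_j pr_j)_K` (`Polarization.single_hom_proj_baseChange_apply_comm_of_mem_lefschetzGroupBaseChange_pi`,
  `Polarization.single_proj_baseChange_apply_comm_of_…`), its off-diagonal blocks vanish
  (`Polarization.proj_baseChange_apply_single_baseChange_of_ne_of_…`), its diagonal blocks
  `Polarization.lefschetzGroupBaseChangePiBlock hγ j = (pr_j)_K γ (in_j)_K ∈ GL(K ⊗ W_j)` satisfy `γ (in_j)_K = (in_j)_K block_j`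
  (`Polarization.apply_single_baseChange_of_…`) and LIE IN `S(H_j)(K)` (`Polarization.lefschetzGroupBaseChangePiBlock_mem`), and
  `γ = ⊕_j block_j(γ)` (`Polarization.eq_piBlockDiag_lefschetzGroupBaseChangePiBlock`); hence
  **`Polarization.lefschetzGroupBaseChange_pi_le_map_piBlockDiag : S(⊕_j H_j)(K) ≤ (Π_j S(H_j)(K)).map piBlockDiag`**.
* §2 **`⊕_j γ_j ∈ S(⊕_j H_j)(K)`, exactly** (`Polarization.piBlockDiag_mem_lefschetzGroupBaseChange_pi_iff`): iff every
  `γ_j ∈ S(H_j)(K)` and `φ_K γ_j = γ_i φ_K` for every morphism `φ : H_j → H_i` between distinct summands — from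
  `Polarization.forall_baseChange_pi_form_piBlockDiag_iff` (`⊕ γ_j` is a `(⊕Q)_K`-isometry iff blockwise) and
  `forall_endAlg_pi_baseChange_piBlockDiag_comm_iff` (`⊕ γ_j` commutes with `End_HS(⊕H)_K` iff it intertwines all `φ_K`; the
  blocks `pr_i a in_j` of `a ∈ End_HS(⊕H)` are morphisms `H_j → H_i`).
* §3 **Proposition 1.5 on `K`-points**: `⊕_j γ_j ∈ S(⊕_j H_j)(K)` for ALL families `γ_j ∈ S(H_j)(K)` iff `Hom(H_j, H_i) = 0` for
  `i ≠ j` (`Polarization.forall_piBlockDiag_mem_lefschetzGroupBaseChange_pi_iff`; "⟹" tests `(1, …, -1_j, …, 1)` and descends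
  `φ_K = 0 ⟹ φ = 0` by faithful flatness, g18-#5's `Hom.toLinearMap_eq_zero_of_baseChange_eq_zero`); then
  **`Polarization.lefschetzGroupBaseChange_pi_eq_map_piBlockDiag_of_hom_eq_zero : S(⊕_j H_j)(K) = (Π_j S(H_j)(K)).map piBlockDiag`**,
  `Polarization.mem_lefschetzGroupBaseChange_pi_iff_of_hom_eq_zero`, and the group isomorphism
  **`Polarization.lefschetzGroupBaseChangePiMulEquiv K Q h0 : (∀ j, S(H_j)(K)) ≃* S(⊕_j H_j)(K)`**, `(γ_j) ↦ ⊕_j γ_j`.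
* §4 **powers, "`S(A) = S(A^r)`"**: in `S(H₀^{⊕ι})(K)` all diagonal blocks coincide
  (`Polarization.lefschetzGroupBaseChangePiBlock_eq_of_pi_const`; `γ` commutes with `(in_i pr_j)_K`), so `γ = Δ(block_{j₀}(γ))`
  (`Polarization.eq_piDiagEmbedding_of_mem_lefschetzGroupBaseChange_pi_const`); conversely `Δ(γ₀) ∈ S(H₀^{⊕ι})(K)` for
  `γ₀ ∈ S(H₀)(K)` (`Polarization.piDiagEmbedding_mem_lefschetzGroupBaseChange_pi_const`, `…_iff`); hence for `ι` non-empty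
  `Polarization.mem_lefschetzGroupBaseChange_pi_const_iff`,
  **`Polarization.lefschetzGroupBaseChange_pi_const_eq_map_piDiagEmbedding : S(H₀^{⊕ι})(K) = Δ S(H₀)(K)`** and
  **`Polarization.lefschetzGroupBaseChangePiConstMulEquiv K ι Q₀ : S(H₀)(K) ≃* S(H₀^{⊕ι})(K)`**.

NOT here: the isogeny clause and "independent of the choice of the isogeny" (isogeny invariance of `S`; tree `Milne1999/…` BY
NAME); the scheme `S(A)` itself (only its points in fields `K ⊇ ℚ`); the algebra `C(⊕_j H_j) ⊗ K` (g21-#2 does `C` over `ℚ`).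

## References

* [Milne1999LefschetzClasses] J. S. Milne, *Lefschetz classes on abelian varieties*, Duke Math. J. 96 (1999) 639–675, §1
  p. 644 (the group `S(A)`, Proposition 1.5, Remark 1.6), p. 643 (Proposition 1.1, `C(A^r) = C(A)`), §3 p. 654 ("S(A) = S(A^r)").
* [Moonen2004MT] B. Moonen, *An introduction to Mumford–Tate groups* (2004), §4 Lemma 4.6, Exercise 4.10.
* [DeligneHodgeII1971] P. Deligne, *Théorie de Hodge II*, Publ. Math. IHÉS 40 (1971), 2.1, 2.1.15 (direct sums, morphisms,
  the product polarization).
* [BourbakiAlgebraI1989] N. Bourbaki, *Algebra I*, Ch. II §5 no. 3 Prop. 7 (extension of scalars is faithful over a field).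
-/

noncomputable section

open TensorProduct

namespace Literature.AlgebraicGeometry.Motives

namespace HodgeStructure

universe u uK

variable (K : Type uK) [Field K] [Algebra ℚ K] {ι : Type} [Fintype ι] [DecidableEq ι]
  {W : ι → Type u} [∀ j, AddCommGroup (W j)] [∀ j, Module ℚ (W j)] {n : ℤ}
  {H : ∀ j, HodgeStructure (W j) n} (Q : ∀ j, Polarization (H j))

/-! ## §0 Base change of the block calculus on `Π_j W_j` (`(in_j)_K`, `(pr_j)_K`) and of the direct-sum form -/

section Plumbing

omit [Fintype ι] in
/-- `(pr_j)_K ((in_j)_K z) = z`. Private plumbing (the tree's copy in `Motives/MumfordTateGroupDiagonal` is private). [folklore] -/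
private theorem proj_baseChange_single_baseChange_same' (j : ι) (z : K ⊗[ℚ] W j) :
    (LinearMap.proj j : (∀ k, W k) →ₗ[ℚ] W j).baseChange K ((LinearMap.single ℚ W j).baseChange K z) = z :=
  baseChange_retract_apply K (ι := LinearMap.single ℚ W j) (π := (LinearMap.proj j : (∀ k, W k) →ₗ[ℚ] W j))
    (fun v ↦ by simp) z

omit [Fintype ι] in
/-- `(pr_i)_K ((in_j)_K z) = 0` for `i ≠ j`. Private plumbing. [folklore] -/
private theorem proj_baseChange_single_baseChange_of_ne' {i j : ι} (h : i ≠ j) (z : K ⊗[ℚ] W j) :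
    (LinearMap.proj i : (∀ k, W k) →ₗ[ℚ] W i).baseChange K ((LinearMap.single ℚ W j).baseChange K z) = 0 := by
  rw [← LinearMap.comp_apply, ← LinearMap.baseChange_comp, LinearMap.proj_comp_single_ne ℚ W i j h,
    LinearMap.baseChange_zero, LinearMap.zero_apply]

/-- `Σ_j (in_j)_K ((pr_j)_K x) = x` on `K ⊗ (Π_j W_j)`. Private plumbing. [folklore] -/
private theorem sum_single_baseChange_proj_baseChange' (x : K ⊗[ℚ] (∀ j, W j)) :
    ∑ j, (LinearMap.single ℚ W j).baseChange K ((LinearMap.proj j : (∀ k, W k) →ₗ[ℚ] W j).baseChange K x) = x := by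
  induction x using TensorProduct.induction_on with
  | zero => simp
  | tmul c v =>
    simp only [LinearMap.baseChange_tmul, LinearMap.coe_proj, Function.eval, LinearMap.coe_single]
    rw [← TensorProduct.tmul_sum, Finset.univ_sum_single]
  | add x y hx hy =>
    simp only [map_add, Finset.sum_add_distrib]
    rw [hx, hy]

/-- Two vectors of `K ⊗ (Π_j W_j)` with the same projections are equal. Private plumbing. [folklore] -/
private theorem eq_of_forall_proj_baseChange_eq' {x y : K ⊗[ℚ] (∀ j, W j)}
    (h : ∀ j, (LinearMap.proj j : (∀ k, W k) →ₗ[ℚ] W j).baseChange K x =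
      (LinearMap.proj j : (∀ k, W k) →ₗ[ℚ] W j).baseChange K y) : x = y := by
  rw [← sum_single_baseChange_proj_baseChange' K x, ← sum_single_baseChange_proj_baseChange' K y]
  exact Finset.sum_congr rfl fun j _ ↦ by rw [h j]

omit [Fintype ι] in
/-- `(pr_i a in_j)_K z = (pr_i)_K (a_K ((in_j)_K z))`: the base change of a block is the block of the base change.
Private plumbing. [folklore] -/
private theorem baseChange_block_apply' (a : Module.End ℚ (∀ j, W j)) (i j : ι) (z : K ⊗[ℚ] W j) :
    (LinearMap.proj i ∘ₗ a ∘ₗ LinearMap.single ℚ W j).baseChange K z =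
      (LinearMap.proj i : (∀ k, W k) →ₗ[ℚ] W i).baseChange K (a.baseChange K ((LinearMap.single ℚ W j).baseChange K z)) := by
  simp only [LinearMap.baseChange_comp, LinearMap.coe_comp, Function.comp_apply]

/-- `piBlockDiag γ ((in_j)_K z) = (in_j)_K (γ_j z)` (pointwise form of the tree's `piBlockDiag_comp_single_baseChange`).
Private plumbing. [folklore] -/
private theorem piBlockDiag_single_baseChange_apply' (γ : ∀ j, (K ⊗[ℚ] W j) ≃ₗ[K] (K ⊗[ℚ] W j)) (j : ι)
    (z : K ⊗[ℚ] W j) :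
    piBlockDiag K W γ ((LinearMap.single ℚ W j).baseChange K z) = (LinearMap.single ℚ W j).baseChange K (γ j z) := by
  have h := LinearMap.congr_fun (piBlockDiag_comp_single_baseChange (K := K) (W := W) γ j) z
  simpa only [LinearMap.coe_comp, Function.comp_apply, LinearEquiv.coe_coe] using h

/-- `(pr_j)_K (piBlockDiag γ x) = γ_j ((pr_j)_K x)` (pointwise form of the tree's `proj_baseChange_comp_piBlockDiag`).
Private plumbing. [folklore] -/
private theorem proj_baseChange_piBlockDiag_apply' (γ : ∀ j, (K ⊗[ℚ] W j) ≃ₗ[K] (K ⊗[ℚ] W j)) (j : ι)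
    (x : K ⊗[ℚ] (∀ k, W k)) :
    (LinearMap.proj j : (∀ k, W k) →ₗ[ℚ] W j).baseChange K (piBlockDiag K W γ x) =
      γ j ((LinearMap.proj j : (∀ k, W k) →ₗ[ℚ] W j).baseChange K x) := by
  have h := LinearMap.congr_fun (proj_baseChange_comp_piBlockDiag (K := K) (W := W) γ j) x
  simpa only [LinearMap.coe_comp, Function.comp_apply, LinearEquiv.coe_coe] using h

/-- **The direct-sum form after extension of scalars, block by block**:
`(⊕_j Q_j)_K(x, y) = Σ_j (Q_j)_K((pr_j)_K x, (pr_j)_K y)` for every field `K ⊇ ℚ` (checked on pure tensors; the tree's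
`Polarization.pi_form_baseChange_apply` of `Motives/HodgeGroupOfCMFamilyPoints` is the same statement inside the CM story and
`Polarization.baseChange_prod_form_apply` of `Motives/HodgeStructureLefschetzGroupDirectSumPoints` the binary case).
[cite: DeligneHodgeII1971, 2.1.15] [cite: Milne1999LefschetzClasses, §1 p. 643 L21–L27 and Remark 1.6] -/
theorem Polarization.baseChange_pi_form_apply (x y : K ⊗[ℚ] (∀ j, W j)) :
    (Polarization.pi Q).form.baseChange K x y =
      ∑ j, (Q j).form.baseChange K ((LinearMap.proj j : (∀ k, W k) →ₗ[ℚ] W j).baseChange K x)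
        ((LinearMap.proj j : (∀ k, W k) →ₗ[ℚ] W j).baseChange K y) := by
  change LinearMap.BilinForm.baseChange K (∑ j, (Q j).form.compl₁₂ (LinearMap.proj j) (LinearMap.proj j)) x y = _
  induction x using TensorProduct.induction_on with
  | zero => simp
  | tmul a v =>
    induction y using TensorProduct.induction_on with
    | zero => simp
    | tmul b w =>
      simp only [LinearMap.BilinForm.baseChange_tmul, LinearMap.baseChange_tmul, LinearMap.coe_proj, Function.eval,
        LinearMap.coe_sum, Finset.sum_apply, LinearMap.compl₁₂_apply, Finset.sum_smul]
    | add y₁ y₂ h₁ h₂ => simp only [map_add, h₁, h₂, ← Finset.sum_add_distrib]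
  | add x₁ x₂ h₁ h₂ => simp only [map_add, LinearMap.add_apply, h₁, h₂, ← Finset.sum_add_distrib]

/-- **On included vectors of the same summand: `(⊕_j Q_j)_K((in_j)_K x, (in_j)_K y) = (Q_j)_K(x, y)`.**
[cite: DeligneHodgeII1971, 2.1.15] [cite: Milne1999LefschetzClasses, §1 p. 643 L21–L27] -/
theorem Polarization.baseChange_pi_form_single_baseChange_same (j : ι) (x y : K ⊗[ℚ] W j) :
    (Polarization.pi Q).form.baseChange K ((LinearMap.single ℚ W j).baseChange K x)
        ((LinearMap.single ℚ W j).baseChange K y) = (Q j).form.baseChange K x y := by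
  rw [Polarization.baseChange_pi_form_apply, Finset.sum_eq_single j]
  · rw [proj_baseChange_single_baseChange_same', proj_baseChange_single_baseChange_same']
  · intro i _ hij
    rw [proj_baseChange_single_baseChange_of_ne' K hij, map_zero, LinearMap.zero_apply]
  · exact fun h ↦ (h (Finset.mem_univ j)).elim

/-- **Distinct summands are orthogonal: `(⊕_j Q_j)_K((in_i)_K x, (in_j)_K y) = 0` for `i ≠ j`.**
[cite: DeligneHodgeII1971, 2.1.15] [cite: Milne1999LefschetzClasses, §1 p. 643 L21–L27] -/
theorem Polarization.baseChange_pi_form_single_baseChange_of_ne {i j : ι} (hij : i ≠ j) (x : K ⊗[ℚ] W i)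
    (y : K ⊗[ℚ] W j) :
    (Polarization.pi Q).form.baseChange K ((LinearMap.single ℚ W i).baseChange K x)
        ((LinearMap.single ℚ W j).baseChange K y) = 0 := by
  rw [Polarization.baseChange_pi_form_apply]
  refine Finset.sum_eq_zero fun k _ ↦ ?_
  by_cases hki : k = i
  · subst hki
    rw [proj_baseChange_single_baseChange_of_ne' K hij, map_zero]
  · rw [proj_baseChange_single_baseChange_of_ne' K hki, map_zero, LinearMap.zero_apply]

end Plumbing

/-! ## §1 `S(⊕_j H_j)(K) ⊆ ∏_j S(H_j)(K)`: every `γ ∈ S(⊕_j H_j)(K)` is block diagonal with blocks in the `S(H_j)(K)` -/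

section Restrict

variable {K Q}

/-- An element of `S(⊕_j H_j)(K)` commutes with `(in_i φ pr_j)_K` for every morphism `φ : H_j → H_i` (`in_i φ pr_j` is a
Hodge endomorphism of `⊕_j H_j`: Prop. 1.1's intertwining relations, on `K`-points). [cite: Milne1999LefschetzClasses, §1 p. 643 ("C(A) ⊂ C(A₁) × ⋯ × C(A_s)") and p. 644 L16–L20] -/
theorem Polarization.single_hom_proj_baseChange_apply_comm_of_mem_lefschetzGroupBaseChange_pi
    {γ : (K ⊗[ℚ] (∀ j, W j)) ≃ₗ[K] (K ⊗[ℚ] (∀ j, W j))} (hγ : γ ∈ (Polarization.pi Q).lefschetzGroupBaseChange K)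
    {i j : ι} (φ : Hom (H j) (H i)) (x : K ⊗[ℚ] (∀ j, W j)) :
    (LinearMap.single ℚ W i ∘ₗ φ.toLinearMap ∘ₗ LinearMap.proj j).baseChange K (γ x) =
      γ ((LinearMap.single ℚ W i ∘ₗ φ.toLinearMap ∘ₗ LinearMap.proj j).baseChange K x) :=
  hγ.1 ⟨LinearMap.single ℚ W i ∘ₗ φ.toLinearMap ∘ₗ LinearMap.proj j,
    Hom.toLinearMap_mem_endAlg ((Hom.piSingle H i).comp (φ.comp (Hom.piProj H j)))⟩ x

/-- An element of `S(⊕_j H_j)(K)` commutes with the base-changed Hodge idempotent `(in_j pr_j)_K` (pointwise).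
[cite: Milne1999LefschetzClasses, §1 p. 644 L16–L20] [cite: Moonen2004MT, §4 Lemma 4.6] -/
theorem Polarization.single_proj_baseChange_apply_comm_of_mem_lefschetzGroupBaseChange_pi
    {γ : (K ⊗[ℚ] (∀ j, W j)) ≃ₗ[K] (K ⊗[ℚ] (∀ j, W j))} (hγ : γ ∈ (Polarization.pi Q).lefschetzGroupBaseChange K)
    (j : ι) (x : K ⊗[ℚ] (∀ j, W j)) :
    (LinearMap.single ℚ W j).baseChange K ((LinearMap.proj j : (∀ k, W k) →ₗ[ℚ] W j).baseChange K (γ x)) =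
      γ ((LinearMap.single ℚ W j).baseChange K ((LinearMap.proj j : (∀ k, W k) →ₗ[ℚ] W j).baseChange K x)) := by
  have h := hγ.1 ⟨LinearMap.single ℚ W j ∘ₗ LinearMap.proj j,
    Hom.toLinearMap_mem_endAlg ((Hom.piSingle H j).comp (Hom.piProj H j))⟩ x
  simpa only [LinearMap.baseChange_comp, LinearMap.coe_comp, Function.comp_apply] using h

/-- **Off-diagonal vanishing**: for `γ ∈ S(⊕_j H_j)(K)`, `(pr_i)_K (γ ((in_j)_K z)) = 0` when `i ≠ j`.
[cite: Milne1999LefschetzClasses, §1 p. 643 ("C(A) ⊂ C(A₁) × ⋯ × C(A_s)") and Remark 1.6] [cite: Moonen2004MT, §4 Lemma 4.6] -/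
theorem Polarization.proj_baseChange_apply_single_baseChange_of_ne_of_mem_lefschetzGroupBaseChange_pi
    {γ : (K ⊗[ℚ] (∀ j, W j)) ≃ₗ[K] (K ⊗[ℚ] (∀ j, W j))} (hγ : γ ∈ (Polarization.pi Q).lefschetzGroupBaseChange K)
    {i j : ι} (hij : i ≠ j) (z : K ⊗[ℚ] W j) :
    (LinearMap.proj i : (∀ k, W k) →ₗ[ℚ] W i).baseChange K (γ ((LinearMap.single ℚ W j).baseChange K z)) = 0 := by
  have hz : (LinearMap.single ℚ W j).baseChange K z = (LinearMap.single ℚ W j).baseChange K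
      ((LinearMap.proj j : (∀ k, W k) →ₗ[ℚ] W j).baseChange K ((LinearMap.single ℚ W j).baseChange K z)) := by
    rw [proj_baseChange_single_baseChange_same']
  rw [hz, ← Polarization.single_proj_baseChange_apply_comm_of_mem_lefschetzGroupBaseChange_pi hγ j,
    proj_baseChange_single_baseChange_of_ne' K hij]

/-- **The `j`-th diagonal block `(pr_j)_K γ (in_j)_K` of `γ ∈ S(⊕_k H_k)(K)` as an automorphism of `K ⊗ W_j`** (the
restriction of `γ` to the retract `(in_j, pr_j)`; the tree's `restrictRetract`, Moonen's Lemma 4.6 machinery).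
[cite: Milne1999LefschetzClasses, §1 Prop. 1.5 (p. 644) and Remark 1.6] [cite: Moonen2004MT, §4 Lemma 4.6] -/
def Polarization.lefschetzGroupBaseChangePiBlock {γ : (K ⊗[ℚ] (∀ j, W j)) ≃ₗ[K] (K ⊗[ℚ] (∀ j, W j))}
    (hγ : γ ∈ (Polarization.pi Q).lefschetzGroupBaseChange K) (j : ι) : (K ⊗[ℚ] W j) ≃ₗ[K] (K ⊗[ℚ] W j) :=
  restrictRetract ((LinearMap.single ℚ W j).baseChange K) ((LinearMap.proj j : (∀ k, W k) →ₗ[ℚ] W j).baseChange K)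
    (proj_baseChange_single_baseChange_same' K j) γ
    (Polarization.single_proj_baseChange_apply_comm_of_mem_lefschetzGroupBaseChange_pi hγ j)

/-- `block_j(γ) z = (pr_j)_K (γ ((in_j)_K z))`. [cite: Moonen2004MT, §4 Lemma 4.6] -/
@[simp] theorem Polarization.lefschetzGroupBaseChangePiBlock_apply {γ : (K ⊗[ℚ] (∀ j, W j)) ≃ₗ[K] (K ⊗[ℚ] (∀ j, W j))}
    (hγ : γ ∈ (Polarization.pi Q).lefschetzGroupBaseChange K) (j : ι) (z : K ⊗[ℚ] W j) :
    Polarization.lefschetzGroupBaseChangePiBlock hγ j z =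
      (LinearMap.proj j : (∀ k, W k) →ₗ[ℚ] W j).baseChange K (γ ((LinearMap.single ℚ W j).baseChange K z)) :=
  rfl

/-- **`γ ∈ S(⊕_j H_j)(K)` preserves each summand: `γ ((in_j)_K z) = (in_j)_K (block_j(γ) z)`.**
[cite: Milne1999LefschetzClasses, §1 p. 643 ("C(A) ⊂ C(A₁) × ⋯ × C(A_s)") and Remark 1.6] [cite: Moonen2004MT, §4 Lemma 4.6] -/
theorem Polarization.apply_single_baseChange_of_mem_lefschetzGroupBaseChange_pi
    {γ : (K ⊗[ℚ] (∀ j, W j)) ≃ₗ[K] (K ⊗[ℚ] (∀ j, W j))} (hγ : γ ∈ (Polarization.pi Q).lefschetzGroupBaseChange K)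
    (j : ι) (z : K ⊗[ℚ] W j) :
    γ ((LinearMap.single ℚ W j).baseChange K z) =
      (LinearMap.single ℚ W j).baseChange K (Polarization.lefschetzGroupBaseChangePiBlock hγ j z) := by
  rw [Polarization.lefschetzGroupBaseChangePiBlock_apply,
    Polarization.single_proj_baseChange_apply_comm_of_mem_lefschetzGroupBaseChange_pi hγ j,
    proj_baseChange_single_baseChange_same']

/-- **The `j`-th block of `γ ∈ S(⊕_k H_k)(K)` lies in `S(H_j)(K)`** ("`S(A) ⊂ S(A₁) × ⋯ × S(A_s)`" on `K`-points): it commutes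
with `a_K` for `a ∈ End_HS(H_j)` because `γ` commutes with `(in_j a pr_j)_K`, and it preserves `(Q_j)_K` because
`(Q_j)_K(x, y) = (⊕Q)_K((in_j)_K x, (in_j)_K y)`. [cite: Milne1999LefschetzClasses, §1 Prop. 1.5 (p. 644) and Remark 1.6] -/
theorem Polarization.lefschetzGroupBaseChangePiBlock_mem {γ : (K ⊗[ℚ] (∀ j, W j)) ≃ₗ[K] (K ⊗[ℚ] (∀ j, W j))}
    (hγ : γ ∈ (Polarization.pi Q).lefschetzGroupBaseChange K) (j : ι) :
    Polarization.lefschetzGroupBaseChangePiBlock hγ j ∈ (Q j).lefschetzGroupBaseChange K := by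
  refine ⟨fun a z ↦ ?_, fun x y ↦ ?_⟩
  · rw [Polarization.lefschetzGroupBaseChangePiBlock_apply, Polarization.lefschetzGroupBaseChangePiBlock_apply]
    have hmem : LinearMap.single ℚ W j ∘ₗ (a : Module.End ℚ (W j)) ∘ₗ LinearMap.proj j ∈ (HodgeStructure.pi H).endAlg :=
      Hom.toLinearMap_mem_endAlg ((Hom.piSingle H j).comp ((endAlg.toHom a).comp (Hom.piProj H j)))
    have h := hγ.1 ⟨_, hmem⟩ ((LinearMap.single ℚ W j).baseChange K z)
    simp only [LinearMap.baseChange_comp, LinearMap.coe_comp, Function.comp_apply,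
      proj_baseChange_single_baseChange_same'] at h
    rw [← h, proj_baseChange_single_baseChange_same']
  · calc (Q j).form.baseChange K (Polarization.lefschetzGroupBaseChangePiBlock hγ j x)
          (Polarization.lefschetzGroupBaseChangePiBlock hγ j y)
        = (Polarization.pi Q).form.baseChange K
            ((LinearMap.single ℚ W j).baseChange K (Polarization.lefschetzGroupBaseChangePiBlock hγ j x))
            ((LinearMap.single ℚ W j).baseChange K (Polarization.lefschetzGroupBaseChangePiBlock hγ j y)) :=
          (Polarization.baseChange_pi_form_single_baseChange_same K Q j _ _).symm
      _ = (Polarization.pi Q).form.baseChange K (γ ((LinearMap.single ℚ W j).baseChange K x))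
            (γ ((LinearMap.single ℚ W j).baseChange K y)) := by
          rw [← Polarization.apply_single_baseChange_of_mem_lefschetzGroupBaseChange_pi hγ j x,
            ← Polarization.apply_single_baseChange_of_mem_lefschetzGroupBaseChange_pi hγ j y]
      _ = (Polarization.pi Q).form.baseChange K ((LinearMap.single ℚ W j).baseChange K x)
            ((LinearMap.single ℚ W j).baseChange K y) := hγ.2 _ _
      _ = (Q j).form.baseChange K x y := Polarization.baseChange_pi_form_single_baseChange_same K Q j x y

/-- **`γ ∈ S(⊕_j H_j)(K)` is the block-diagonal automorphism of its diagonal blocks: `γ = ⊕_j block_j(γ)`** (the tree's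
`piBlockDiag`). [cite: Milne1999LefschetzClasses, §1 Prop. 1.5 (p. 644) and Remark 1.6] [cite: Moonen2004MT, §4 Lemma 4.6] -/
theorem Polarization.eq_piBlockDiag_lefschetzGroupBaseChangePiBlock
    {γ : (K ⊗[ℚ] (∀ j, W j)) ≃ₗ[K] (K ⊗[ℚ] (∀ j, W j))} (hγ : γ ∈ (Polarization.pi Q).lefschetzGroupBaseChange K) :
    γ = piBlockDiag K W fun j ↦ Polarization.lefschetzGroupBaseChangePiBlock hγ j := by
  refine LinearEquiv.ext fun x ↦ ?_
  have h : (piBlockDiag K W fun j ↦ Polarization.lefschetzGroupBaseChangePiBlock hγ j) x =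
      ∑ j, (LinearMap.single ℚ W j).baseChange K (Polarization.lefschetzGroupBaseChangePiBlock hγ j
        ((LinearMap.proj j : (∀ k, W k) →ₗ[ℚ] W j).baseChange K x)) := by
    have h' := LinearMap.congr_fun (coe_piBlockDiag (K := K) (W := W)
      fun j ↦ Polarization.lefschetzGroupBaseChangePiBlock hγ j) x
    simpa only [LinearEquiv.coe_coe, LinearMap.sum_apply, LinearMap.coe_comp, Function.comp_apply] using h'
  rw [h]
  simp only [Polarization.lefschetzGroupBaseChangePiBlock_apply]
  conv_lhs => rw [← sum_single_baseChange_proj_baseChange' K x, map_sum]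
  refine Finset.sum_congr rfl fun j _ ↦ ?_
  rw [Polarization.single_proj_baseChange_apply_comm_of_mem_lefschetzGroupBaseChange_pi hγ j,
    proj_baseChange_single_baseChange_same']

variable (K Q) in
/-- **Proposition 1.5, inclusion, on `K`-points for a finite family: `S(⊕_j H_j)(K) ⊆ ∏_j S(H_j)(K)`** through the
block-diagonal embedding `piBlockDiag` (every field `K ⊇ ℚ`; no hypothesis on the summands).
[cite: Milne1999LefschetzClasses, §1 Prop. 1.5 (p. 644) and Remark 1.6] -/
theorem Polarization.lefschetzGroupBaseChange_pi_le_map_piBlockDiag :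
    (Polarization.pi Q).lefschetzGroupBaseChange K ≤
      (Subgroup.pi Set.univ fun j ↦ (Q j).lefschetzGroupBaseChange K).map (piBlockDiag K W) := fun _ hγ ↦
  ⟨fun j ↦ Polarization.lefschetzGroupBaseChangePiBlock hγ j, fun j _ ↦ Polarization.lefschetzGroupBaseChangePiBlock_mem hγ j,
    (Polarization.eq_piBlockDiag_lefschetzGroupBaseChangePiBlock hγ).symm⟩

end Restrict

/-! ## §2 `⊕_j γ_j ∈ S(⊕_j H_j)(K)`, exactly: blockwise isometry and the intertwining relations -/

section BlockDiag

variable {K}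

/-- `⊕_j γ_j` preserves `(⊕_j Q_j)_K` iff every `γ_j` preserves `(Q_j)_K`. [cite: Milne1999LefschetzClasses, §1 p. 643 L21–L27 and Prop. 1.5] -/
theorem Polarization.forall_baseChange_pi_form_piBlockDiag_iff (γ : ∀ j, (K ⊗[ℚ] W j) ≃ₗ[K] (K ⊗[ℚ] W j)) :
    (∀ x y, (Polarization.pi Q).form.baseChange K (piBlockDiag K W γ x) (piBlockDiag K W γ y) =
        (Polarization.pi Q).form.baseChange K x y) ↔
      ∀ j (x y : K ⊗[ℚ] W j), (Q j).form.baseChange K (γ j x) (γ j y) = (Q j).form.baseChange K x y := by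
  constructor
  · intro h j x y
    rw [← Polarization.baseChange_pi_form_single_baseChange_same K Q j (γ j x),
      ← Polarization.baseChange_pi_form_single_baseChange_same K Q j x,
      ← piBlockDiag_single_baseChange_apply', ← piBlockDiag_single_baseChange_apply']
    exact h _ _
  · intro h x y
    rw [Polarization.baseChange_pi_form_apply, Polarization.baseChange_pi_form_apply]
    refine Finset.sum_congr rfl fun j _ ↦ ?_
    rw [proj_baseChange_piBlockDiag_apply', proj_baseChange_piBlockDiag_apply', h j]

omit Q in
/-- `⊕_j γ_j` commutes with `a_K` for every `a ∈ End_HS(⊕_j H_j)` iff the family intertwines the base change of every morphism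
between the summands: `φ_K γ_j = γ_i φ_K` for `φ : H_j → H_i` (the blocks `pr_i a in_j` of `a` ARE such morphisms).
[cite: Milne1999LefschetzClasses, §1 p. 643 ("with equality holding if and only if Hom(Aᵢ, Aⱼ) = 0")] [cite: DeligneHodgeII1971, 2.1] -/
theorem forall_endAlg_pi_baseChange_piBlockDiag_comm_iff (γ : ∀ j, (K ⊗[ℚ] W j) ≃ₗ[K] (K ⊗[ℚ] W j)) :
    (∀ a : (HodgeStructure.pi H).endAlg, ∀ x,
        (a : Module.End ℚ (∀ j, W j)).baseChange K (piBlockDiag K W γ x) =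
          piBlockDiag K W γ ((a : Module.End ℚ (∀ j, W j)).baseChange K x)) ↔
      ∀ i j (φ : Hom (H j) (H i)) (z : K ⊗[ℚ] W j),
        φ.toLinearMap.baseChange K (γ j z) = γ i (φ.toLinearMap.baseChange K z) := by
  constructor
  · intro h i j φ z
    have hmem : LinearMap.single ℚ W i ∘ₗ φ.toLinearMap ∘ₗ LinearMap.proj j ∈ (HodgeStructure.pi H).endAlg :=
      Hom.toLinearMap_mem_endAlg ((Hom.piSingle H i).comp (φ.comp (Hom.piProj H j)))
    have h1 := h ⟨_, hmem⟩ ((LinearMap.single ℚ W j).baseChange K z)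
    rw [piBlockDiag_single_baseChange_apply'] at h1
    simp only [LinearMap.baseChange_comp, LinearMap.coe_comp, Function.comp_apply,
      proj_baseChange_single_baseChange_same', piBlockDiag_single_baseChange_apply'] at h1
    have h2 := congr_arg ((LinearMap.proj i : (∀ k, W k) →ₗ[ℚ] W i).baseChange K) h1
    simpa only [proj_baseChange_single_baseChange_same'] using h2
  · intro h a x
    suffices key : ∀ (j : ι) (z : K ⊗[ℚ] W j),
        (a : Module.End ℚ (∀ j, W j)).baseChange K (piBlockDiag K W γ ((LinearMap.single ℚ W j).baseChange K z)) =
          piBlockDiag K W γ ((a : Module.End ℚ (∀ j, W j)).baseChange K ((LinearMap.single ℚ W j).baseChange K z)) by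
      conv_lhs => rw [← sum_single_baseChange_proj_baseChange' K x]
      conv_rhs => rw [← sum_single_baseChange_proj_baseChange' K x]
      simp only [map_sum, key]
    intro j z
    -- the blocks `φ_i = pr_i a in_j : H_j → H_i` of `a`
    let φ : ∀ i, Hom (H j) (H i) := fun i ↦ (Hom.piProj H i).comp ((endAlg.toHom a).comp (Hom.piSingle H j))
    have hdec : ∀ w : K ⊗[ℚ] W j, (a : Module.End ℚ (∀ j, W j)).baseChange K ((LinearMap.single ℚ W j).baseChange K w) =
        ∑ i, (LinearMap.single ℚ W i).baseChange K ((φ i).toLinearMap.baseChange K w) := by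
      intro w
      conv_lhs => rw [← sum_single_baseChange_proj_baseChange' K
        ((a : Module.End ℚ (∀ j, W j)).baseChange K ((LinearMap.single ℚ W j).baseChange K w))]
      refine Finset.sum_congr rfl fun i _ ↦ ?_
      rw [← baseChange_block_apply']
      rfl
    rw [piBlockDiag_single_baseChange_apply', hdec, hdec, map_sum]
    refine Finset.sum_congr rfl fun i _ ↦ ?_
    rw [h i j (φ i) z, piBlockDiag_single_baseChange_apply']

/-- **`⊕_j γ_j ∈ S(⊕_j H_j)(K)`, exactly**: iff every `γ_j ∈ S(H_j)(K)` and the family intertwines the base change of every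
morphism between DISTINCT summands (`φ_K γ_j = γ_i φ_K` for `φ : H_j → H_i`, `i ≠ j`) — Prop. 1.1's relations on `K`-points.
[cite: Milne1999LefschetzClasses, §1 p. 643 and Prop. 1.5 (p. 644), Remark 1.6] -/
theorem Polarization.piBlockDiag_mem_lefschetzGroupBaseChange_pi_iff (γ : ∀ j, (K ⊗[ℚ] W j) ≃ₗ[K] (K ⊗[ℚ] W j)) :
    piBlockDiag K W γ ∈ (Polarization.pi Q).lefschetzGroupBaseChange K ↔
      (∀ j, γ j ∈ (Q j).lefschetzGroupBaseChange K) ∧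
        ∀ i j, i ≠ j → ∀ (φ : Hom (H j) (H i)) (z : K ⊗[ℚ] W j),
          φ.toLinearMap.baseChange K (γ j z) = γ i (φ.toLinearMap.baseChange K z) := by
  rw [Polarization.mem_lefschetzGroupBaseChange_iff, forall_endAlg_pi_baseChange_piBlockDiag_comm_iff,
    Polarization.forall_baseChange_pi_form_piBlockDiag_iff]
  constructor
  · rintro ⟨hc, hf⟩
    exact ⟨fun j ↦ ⟨fun a z ↦ hc j j (endAlg.toHom a) z, hf j⟩, fun i j _ φ z ↦ hc i j φ z⟩
  · rintro ⟨hS, h0⟩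
    refine ⟨fun i j φ z ↦ ?_, fun j ↦ ((Q j).mem_lefschetzGroupBaseChange_iff (γ j)).1 (hS j) |>.2⟩
    by_cases hij : i = j
    · cases hij
      exact (((Q i).mem_lefschetzGroupBaseChange_iff (γ i)).1 (hS i)).1 ⟨φ.toLinearMap, Hom.toLinearMap_mem_endAlg φ⟩ z
    · exact h0 i j hij φ z

end BlockDiag

/-! ## §3 Proposition 1.5 on `K`-points: `∏_j S(H_j)(K) → S(⊕_j H_j)(K)` is onto (an isomorphism) iff the summands are
pairwise `Hom`-orthogonal -/

section PropOneFive

variable {K}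

/-- In a `ℚ`-vector space `-x = x` forces `x = 0`. Private plumbing. [folklore] -/
private theorem eq_zero_of_neg_eq_self_ratModule {M : Type*} [AddCommGroup M] [Module ℚ M] {x : M} (h : -x = x) : x = 0 := by
  have h2 : (2 : ℚ) • x = 0 := by
    rw [two_smul]
    nth_rw 1 [← h]
    exact neg_add_cancel x
  exact (smul_eq_zero.1 h2).resolve_left (by norm_num)

/-- **Proposition 1.5 on `K`-points: "`S(A₁) × ⋯ × S(A_s) → S(A)` is an isomorphism" exactly when the summands are pairwise
`Hom`-orthogonal** (Milne: the `Aᵢ` represent distinct simple isogeny classes): for a field `K ⊇ ℚ`, `⊕_j γ_j ∈ S(⊕_j H_j)(K)` for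
ALL families `γ_j ∈ S(H_j)(K)` iff `Hom(H_j, H_i) = 0` for `i ≠ j` ("⟹": the family `(1, …, -1_j, …, 1)` intertwines `φ_K`,
`φ : H_j → H_i`, only if `-φ_K = φ_K`, and `φ_K = 0 ⟹ φ = 0` by faithful flatness of `K/ℚ`).
[cite: Milne1999LefschetzClasses, §1 Prop. 1.5 (p. 644) and Remark 1.6] [cite: BourbakiAlgebraI1989, Ch. II §5 no. 3 Prop. 7 (ii)] -/
theorem Polarization.forall_piBlockDiag_mem_lefschetzGroupBaseChange_pi_iff :
    (∀ γ : ∀ j, (K ⊗[ℚ] W j) ≃ₗ[K] (K ⊗[ℚ] W j), (∀ j, γ j ∈ (Q j).lefschetzGroupBaseChange K) →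
        piBlockDiag K W γ ∈ (Polarization.pi Q).lefschetzGroupBaseChange K) ↔
      ∀ i j, i ≠ j → ∀ φ : Hom (H j) (H i), φ.toLinearMap = 0 := by
  constructor
  · intro h i j hij φ
    set γ : ∀ k, (K ⊗[ℚ] W k) ≃ₗ[K] (K ⊗[ℚ] W k) := fun k ↦ if k = j then LinearEquiv.neg K else 1 with hγ
    have hγS : ∀ k, γ k ∈ (Q k).lefschetzGroupBaseChange K := by
      intro k
      by_cases hk : k = j
      · subst hk
        simp only [hγ, if_true]
        exact (Q k).neg_mem_lefschetzGroupBaseChange K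
      · simp only [hγ, hk, if_false]
        exact Subgroup.one_mem _
    have key := ((Polarization.piBlockDiag_mem_lefschetzGroupBaseChange_pi_iff Q γ).1 (h γ hγS)).2 i j hij φ
    refine Hom.toLinearMap_eq_zero_of_baseChange_eq_zero K fun z ↦ ?_
    have hz := key z
    simp only [hγ, if_true, if_neg hij, LinearEquiv.neg_apply, map_neg, LinearEquiv.coe_one, id_eq] at hz
    exact eq_zero_of_neg_eq_self_ratModule hz
  · intro h0 γ hγ
    exact (Polarization.piBlockDiag_mem_lefschetzGroupBaseChange_pi_iff Q γ).2
      ⟨hγ, fun i j hij φ z ↦ by rw [h0 i j hij φ, LinearMap.baseChange_zero, LinearMap.zero_apply,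
        LinearMap.zero_apply, map_zero]⟩

variable (K) in
/-- **`S(⊕_j H_j)(K) = ∏_j S(H_j)(K)` (block-diagonally embedded) for pairwise `Hom`-orthogonal summands**, for every field
`K ⊇ ℚ` — Proposition 1.5 on `K`-points for a finite family. [cite: Milne1999LefschetzClasses, §1 Prop. 1.5 (p. 644) and Remark 1.6] -/
theorem Polarization.lefschetzGroupBaseChange_pi_eq_map_piBlockDiag_of_hom_eq_zero
    (h0 : ∀ i j, i ≠ j → ∀ φ : Hom (H j) (H i), φ.toLinearMap = 0) :
    (Polarization.pi Q).lefschetzGroupBaseChange K =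
      (Subgroup.pi Set.univ fun j ↦ (Q j).lefschetzGroupBaseChange K).map (piBlockDiag K W) := by
  refine le_antisymm (Polarization.lefschetzGroupBaseChange_pi_le_map_piBlockDiag K Q) ?_
  rintro _ ⟨γ, hγ, rfl⟩
  exact (Polarization.forall_piBlockDiag_mem_lefschetzGroupBaseChange_pi_iff Q).2 h0 γ fun j ↦ hγ j (Set.mem_univ j)

variable (K) in
/-- Membership form: for pairwise `Hom`-orthogonal summands, `γ ∈ S(⊕_j H_j)(K)` iff `γ = ⊕_j γ_j` with `γ_j ∈ S(H_j)(K)`.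
[cite: Milne1999LefschetzClasses, §1 Prop. 1.5 (p. 644) and Remark 1.6] -/
theorem Polarization.mem_lefschetzGroupBaseChange_pi_iff_of_hom_eq_zero
    (h0 : ∀ i j, i ≠ j → ∀ φ : Hom (H j) (H i), φ.toLinearMap = 0)
    (γ : (K ⊗[ℚ] (∀ j, W j)) ≃ₗ[K] (K ⊗[ℚ] (∀ j, W j))) :
    γ ∈ (Polarization.pi Q).lefschetzGroupBaseChange K ↔
      ∃ γ' : ∀ j, (K ⊗[ℚ] W j) ≃ₗ[K] (K ⊗[ℚ] W j),
        (∀ j, γ' j ∈ (Q j).lefschetzGroupBaseChange K) ∧ piBlockDiag K W γ' = γ := by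
  rw [Polarization.lefschetzGroupBaseChange_pi_eq_map_piBlockDiag_of_hom_eq_zero K Q h0]
  constructor
  · rintro ⟨γ', hγ', h⟩
    exact ⟨γ', fun j ↦ hγ' j (Set.mem_univ j), h⟩
  · rintro ⟨γ', hγ', h⟩
    exact ⟨γ', fun j _ ↦ hγ' j, h⟩

variable (K) in
/-- **Proposition 1.5 on `K`-points as an isomorphism of groups `∏_j S(H_j)(K) ≃* S(⊕_j H_j)(K)`, `(γ_j) ↦ ⊕_j γ_j`**, for
pairwise `Hom`-orthogonal summands ("Any such isogeny induces an isomorphism `S(A₁) × ⋯ × S(A_s) → S(A)`"; inverse = the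
diagonal blocks). [cite: Milne1999LefschetzClasses, §1 Prop. 1.5 (p. 644) and Remark 1.6] -/
def Polarization.lefschetzGroupBaseChangePiMulEquiv (h0 : ∀ i j, i ≠ j → ∀ φ : Hom (H j) (H i), φ.toLinearMap = 0) :
    (∀ j, (Q j).lefschetzGroupBaseChange K) ≃* (Polarization.pi Q).lefschetzGroupBaseChange K where
  toFun γ := ⟨piBlockDiag K W fun j ↦ (γ j : (K ⊗[ℚ] W j) ≃ₗ[K] (K ⊗[ℚ] W j)),
    (Polarization.forall_piBlockDiag_mem_lefschetzGroupBaseChange_pi_iff Q).2 h0 _ fun j ↦ (γ j).2⟩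
  invFun γ := fun j ↦ ⟨Polarization.lefschetzGroupBaseChangePiBlock γ.2 j, Polarization.lefschetzGroupBaseChangePiBlock_mem γ.2 j⟩
  left_inv γ := funext fun j ↦ Subtype.ext (LinearEquiv.ext fun z ↦ by
    rw [Polarization.lefschetzGroupBaseChangePiBlock_apply]
    change (LinearMap.proj j : (∀ k, W k) →ₗ[ℚ] W j).baseChange K
      (piBlockDiag K W (fun j ↦ (γ j : (K ⊗[ℚ] W j) ≃ₗ[K] (K ⊗[ℚ] W j))) ((LinearMap.single ℚ W j).baseChange K z)) = _
    rw [piBlockDiag_single_baseChange_apply', proj_baseChange_single_baseChange_same'])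
  right_inv γ := Subtype.ext (Polarization.eq_piBlockDiag_lefschetzGroupBaseChangePiBlock γ.2).symm
  map_mul' γ γ' := Subtype.ext (by
    change piBlockDiag K W (fun j ↦ ((γ * γ') j : (K ⊗[ℚ] W j) ≃ₗ[K] (K ⊗[ℚ] W j))) =
      piBlockDiag K W (fun j ↦ (γ j : (K ⊗[ℚ] W j) ≃ₗ[K] (K ⊗[ℚ] W j))) *
        piBlockDiag K W (fun j ↦ (γ' j : (K ⊗[ℚ] W j) ≃ₗ[K] (K ⊗[ℚ] W j)))
    rw [← map_mul]
    rfl)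

/-- The underlying automorphism of `lefschetzGroupBaseChangePiMulEquiv γ` is `⊕_j γ_j`. [cite: Milne1999LefschetzClasses, §1 Prop. 1.5] -/
@[simp] theorem Polarization.coe_lefschetzGroupBaseChangePiMulEquiv_apply
    (h0 : ∀ i j, i ≠ j → ∀ φ : Hom (H j) (H i), φ.toLinearMap = 0) (γ : ∀ j, (Q j).lefschetzGroupBaseChange K) :
    ((Polarization.lefschetzGroupBaseChangePiMulEquiv K Q h0 γ : (Polarization.pi Q).lefschetzGroupBaseChange K) :
        (K ⊗[ℚ] (∀ j, W j)) ≃ₗ[K] (K ⊗[ℚ] (∀ j, W j))) =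
      piBlockDiag K W fun j ↦ (γ j : (K ⊗[ℚ] W j) ≃ₗ[K] (K ⊗[ℚ] W j)) :=
  rfl

end PropOneFive

/-! ## §4 Powers: `S(H^{⊕ι})(K) = Δ S(H)(K)` ("`S(A)` depends only on the isogeny class of `A`"; "`S(A) = S(A^r)`") -/

section PiConst

variable {K} {V : Type u} [AddCommGroup V] [Module ℚ V] {H₀ : HodgeStructure V n} (Q₀ : Polarization H₀)

/-- **In `S(H₀^{⊕ι})(K)` all diagonal blocks coincide** (`γ` commutes with the base change of the Hodge endomorphism
`in_i pr_j` of the constant family). [cite: Milne1999LefschetzClasses, §1 p. 643 ("the diagonal action of C(A) on rV(A) identifies C(A) with C(A^r)") and Remark 1.6] -/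
theorem Polarization.lefschetzGroupBaseChangePiBlock_eq_of_pi_const
    {γ : (K ⊗[ℚ] (ι → V)) ≃ₗ[K] (K ⊗[ℚ] (ι → V))}
    (hγ : γ ∈ (Polarization.pi fun _ : ι ↦ Q₀).lefschetzGroupBaseChange K) (i j : ι) :
    Polarization.lefschetzGroupBaseChangePiBlock hγ i = Polarization.lefschetzGroupBaseChangePiBlock hγ j := by
  have hE := hγ.1 ⟨LinearMap.single ℚ (fun _ : ι ↦ V) i ∘ₗ LinearMap.proj j,
    Hom.toLinearMap_mem_endAlg ((Hom.piSingle (fun _ : ι ↦ H₀) i).comp (Hom.piProj (fun _ : ι ↦ H₀) j))⟩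
  refine LinearEquiv.ext fun z ↦ ?_
  rw [Polarization.lefschetzGroupBaseChangePiBlock_apply, Polarization.lefschetzGroupBaseChangePiBlock_apply]
  have h1 := hE ((LinearMap.single ℚ (fun _ : ι ↦ V) j).baseChange K z)
  simp only [LinearMap.baseChange_comp, LinearMap.coe_comp, Function.comp_apply,
    proj_baseChange_single_baseChange_same' K (W := fun _ : ι ↦ V)] at h1
  rw [← h1, proj_baseChange_single_baseChange_same' K (W := fun _ : ι ↦ V)]

/-- **`γ ∈ S(H₀^{⊕ι})(K)` is diagonal: `γ = Δ(γ₀)` with `γ₀` any of its (equal) diagonal blocks** (the tree's `piDiagEmbedding`).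
[cite: Milne1999LefschetzClasses, §1 p. 643–644 and Remark 1.6] -/
theorem Polarization.eq_piDiagEmbedding_of_mem_lefschetzGroupBaseChange_pi_const
    {γ : (K ⊗[ℚ] (ι → V)) ≃ₗ[K] (K ⊗[ℚ] (ι → V))}
    (hγ : γ ∈ (Polarization.pi fun _ : ι ↦ Q₀).lefschetzGroupBaseChange K) (j₀ : ι) :
    γ = piDiagEmbedding K V ι (Polarization.lefschetzGroupBaseChangePiBlock hγ j₀) := by
  rw [piDiagEmbedding_apply]
  conv_lhs => rw [Polarization.eq_piBlockDiag_lefschetzGroupBaseChangePiBlock hγ]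
  congr 1
  funext j
  exact Polarization.lefschetzGroupBaseChangePiBlock_eq_of_pi_const Q₀ hγ j j₀

variable (K) in
/-- **`Δ(γ₀) ∈ S(H₀^{⊕ι})(K)` for `γ₀ ∈ S(H₀)(K)`** (the diagonal family intertwines every `φ_K`, `φ ∈ End_HS(H₀)`, because
`γ₀` commutes with `E_φ(H₀)_K`). [cite: Milne1999LefschetzClasses, §1 p. 643–644, Prop. 1.5 and Remark 1.6] -/
theorem Polarization.piDiagEmbedding_mem_lefschetzGroupBaseChange_pi_const {γ₀ : (K ⊗[ℚ] V) ≃ₗ[K] (K ⊗[ℚ] V)}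
    (hγ₀ : γ₀ ∈ Q₀.lefschetzGroupBaseChange K) :
    piDiagEmbedding K V ι γ₀ ∈ (Polarization.pi fun _ : ι ↦ Q₀).lefschetzGroupBaseChange K := by
  rw [piDiagEmbedding_apply, Polarization.piBlockDiag_mem_lefschetzGroupBaseChange_pi_iff]
  exact ⟨fun _ ↦ hγ₀, fun i j _ φ z ↦ hγ₀.1 ⟨φ.toLinearMap, Hom.toLinearMap_mem_endAlg φ⟩ z⟩

variable (K) (ι) in
/-- `Δ(γ₀) ∈ S(H₀^{⊕ι})(K) ⟺ γ₀ ∈ S(H₀)(K)` for `ι` non-empty. [cite: Milne1999LefschetzClasses, §1 p. 643–644, Prop. 1.5 and Remark 1.6] -/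
theorem Polarization.piDiagEmbedding_mem_lefschetzGroupBaseChange_pi_const_iff [Nonempty ι]
    (γ₀ : (K ⊗[ℚ] V) ≃ₗ[K] (K ⊗[ℚ] V)) :
    piDiagEmbedding K V ι γ₀ ∈ (Polarization.pi fun _ : ι ↦ Q₀).lefschetzGroupBaseChange K ↔
      γ₀ ∈ Q₀.lefschetzGroupBaseChange K := by
  refine ⟨fun h ↦ ?_, Polarization.piDiagEmbedding_mem_lefschetzGroupBaseChange_pi_const K Q₀⟩
  rw [piDiagEmbedding_apply, Polarization.piBlockDiag_mem_lefschetzGroupBaseChange_pi_iff] at h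
  exact h.1 (Classical.arbitrary ι)

variable (K) in
/-- **`S(H₀^{⊕ι})(K) = Δ S(H₀)(K)`, membership form** (`ι` non-empty): `γ ∈ S(H₀^{⊕ι})(K)` iff `γ = Δ(γ₀)` with `γ₀ ∈ S(H₀)(K)`
("`S(A)` depends only on the isogeny class of `A`"; "`S(A) = S(A^r)`").
[cite: Milne1999LefschetzClasses, §1 p. 644 L21 and Prop. 1.5, §3 p. 654 L16–L17] -/
theorem Polarization.mem_lefschetzGroupBaseChange_pi_const_iff [Nonempty ι]
    (γ : (K ⊗[ℚ] (ι → V)) ≃ₗ[K] (K ⊗[ℚ] (ι → V))) :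
    γ ∈ (Polarization.pi fun _ : ι ↦ Q₀).lefschetzGroupBaseChange K ↔
      ∃ γ₀ ∈ Q₀.lefschetzGroupBaseChange K, piDiagEmbedding K V ι γ₀ = γ := by
  constructor
  · intro hγ
    obtain ⟨j₀⟩ := ‹Nonempty ι›
    exact ⟨Polarization.lefschetzGroupBaseChangePiBlock hγ j₀, Polarization.lefschetzGroupBaseChangePiBlock_mem hγ j₀,
      (Polarization.eq_piDiagEmbedding_of_mem_lefschetzGroupBaseChange_pi_const Q₀ hγ j₀).symm⟩
  · rintro ⟨γ₀, h₀, rfl⟩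
    exact Polarization.piDiagEmbedding_mem_lefschetzGroupBaseChange_pi_const K Q₀ h₀

variable (K) (ι) in
/-- **`S(H₀^{⊕ι})(K) = Δ S(H₀)(K)` as subgroups of `GL(K ⊗ V^{⊕ι})`** (`ι` non-empty).
[cite: Milne1999LefschetzClasses, §1 p. 644 L21 and Prop. 1.5, §3 p. 654 L16–L17] -/
theorem Polarization.lefschetzGroupBaseChange_pi_const_eq_map_piDiagEmbedding [Nonempty ι] :
    (Polarization.pi fun _ : ι ↦ Q₀).lefschetzGroupBaseChange K =
      (Q₀.lefschetzGroupBaseChange K).map (piDiagEmbedding K V ι) :=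
  Subgroup.ext fun γ ↦ (Polarization.mem_lefschetzGroupBaseChange_pi_const_iff K Q₀ γ).trans Subgroup.mem_map.symm

variable (K) (ι) in
/-- **`S(H₀)(K) ≃* S(H₀^{⊕ι})(K)`, `γ₀ ↦ Δ(γ₀)`** (`ι` non-empty; inverse = any diagonal block).
[cite: Milne1999LefschetzClasses, §1 p. 644 L21 and Prop. 1.5, §3 p. 654 L16–L17] -/
def Polarization.lefschetzGroupBaseChangePiConstMulEquiv [Nonempty ι] :
    Q₀.lefschetzGroupBaseChange K ≃* (Polarization.pi fun _ : ι ↦ Q₀).lefschetzGroupBaseChange K where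
  toFun γ₀ := ⟨piDiagEmbedding K V ι γ₀, Polarization.piDiagEmbedding_mem_lefschetzGroupBaseChange_pi_const K Q₀ γ₀.2⟩
  invFun γ := ⟨Polarization.lefschetzGroupBaseChangePiBlock γ.2 (Classical.arbitrary ι),
    Polarization.lefschetzGroupBaseChangePiBlock_mem γ.2 _⟩
  left_inv γ₀ := Subtype.ext (LinearEquiv.ext fun z ↦ by
    rw [Polarization.lefschetzGroupBaseChangePiBlock_apply]
    change (LinearMap.proj (Classical.arbitrary ι) : (ι → V) →ₗ[ℚ] V).baseChange K
      (piDiagEmbedding K V ι (γ₀ : (K ⊗[ℚ] V) ≃ₗ[K] (K ⊗[ℚ] V))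
        ((LinearMap.single ℚ (fun _ : ι ↦ V) (Classical.arbitrary ι)).baseChange K z)) = _
    rw [piDiagEmbedding_apply, piBlockDiag_single_baseChange_apply' K (W := fun _ : ι ↦ V),
      proj_baseChange_single_baseChange_same' K (W := fun _ : ι ↦ V)])
  right_inv γ := Subtype.ext (Polarization.eq_piDiagEmbedding_of_mem_lefschetzGroupBaseChange_pi_const Q₀ γ.2 _).symm
  map_mul' γ₀ γ₀' := Subtype.ext (map_mul (piDiagEmbedding K V ι) _ _)

/-- The underlying automorphism of `lefschetzGroupBaseChangePiConstMulEquiv γ₀` is `Δ(γ₀)`. [cite: Milne1999LefschetzClasses, §1 Prop. 1.5] -/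
@[simp] theorem Polarization.coe_lefschetzGroupBaseChangePiConstMulEquiv_apply [Nonempty ι] (γ₀ : Q₀.lefschetzGroupBaseChange K) :
    ((Polarization.lefschetzGroupBaseChangePiConstMulEquiv K ι Q₀ γ₀ :
        (Polarization.pi fun _ : ι ↦ Q₀).lefschetzGroupBaseChange K) : (K ⊗[ℚ] (ι → V)) ≃ₗ[K] (K ⊗[ℚ] (ι → V))) =
      piDiagEmbedding K V ι (γ₀ : (K ⊗[ℚ] V) ≃ₗ[K] (K ⊗[ℚ] V)) :=
  rfl

end PiConst

end HodgeStructure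

end Literature.AlgebraicGeometry.Motives
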